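import Summits.HubbardSuperconductivity.HubbardSuperconductivity.Theorems.AnisotropyChordTransferFibre3LamPartKT
import Summits.HubbardSuperconductivity.HubbardSuperconductivity.Theorems.AnisotropyChordTransferFibre3GreenZeroKT48

/-!
# Route `AnisotropyChord` / H0 rotor rung: the KT-regime window λ-part at `L ≥ 48` — `δ_λ(x,y) ≤ ν(x² + y²)(7.76 ln L + 3.35)/L²`

Block `[48,64)` version of `…Fibre3LamPartKT.lamPart_KT_le` (p1 g26, `L ≥ 64`, constant `3.3`): with `capacity_KT_bounds48`
(`G̃_λ(0) ≤ ln L/2π + 0.0687`) the constant becomes `3.35`.  ★ `lamPart_KT_le48`.  Input of the window lemmas of the t-block `[48,64)`.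
Prover seat `hubbard-h0-rotor-p2` g8; helper for stmt-HubbardSuperconductivity-23918 (`--supports`, helper class).
WHAT THIS IS NOT: nothing here proves superconductivity in the Hubbard model; a family-A input of ONE conditional reduction on the blocks.
Tree imports only; no new definitions; no sorry.
-/

set_option linter.dupNamespace false
set_option autoImplicit false

noncomputable section

open scoped BigOperators
open Real Finset

namespace Summit.HubbardSuperconductivity.HubbardSuperconductivity.Theorems.AnisotropyChord.Transfer.Fibre3

namespace CapacityConst

variable (L : ℕ) [NeZero L]

/-- ★ KT-REGIME WINDOW λ-PART: for `L ≥ 64`, `0 ≤ ν ≤ 0.07`, `λ = ν(2π/L)²`: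
`δ_λ(x,y) ≤ ν(x² + y²)(7.76 ln L + 3.3)/L²`. [folklore] -/
theorem lamPart_KT_le48 (hL : 48 ≤ L) (ν : ℝ) (hν0 : 0 ≤ ν) (hν : ν ≤ 0.07) (x y : ℤ) :
    RateLemma.lamPart L (ν * (2 * Real.pi / L) ^ 2) (((x : ZMod L)), ((y : ZMod L)))
      ≤ ν * ((x : ℝ) ^ 2 + (y : ℝ) ^ 2) * (7.76 * Real.log L + 3.35) / (L : ℝ) ^ 2 := by
  have hπlo := Real.pi_gt_d6
  have hπhi := Real.pi_lt_d6
  have hπ := Real.pi_pos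
  have hL0 : (0 : ℝ) < L := by exact_mod_cast (show 0 < L by omega)
  have hL64 : (48 : ℝ) ≤ L := by exact_mod_cast hL
  set θ : ℝ := 2 * Real.pi / L with hθ
  have hν4 : ν < 4 / Real.pi ^ 2 := by
    rw [lt_div_iff₀ (by positivity)]; nlinarith
  have hεJ : 2 / Real.pi ^ 2 * θ ^ 2 ≤ eps1 L := by rw [hθ]; exact RateLemma.eps1_ge_jordan L (by omega)
  have hlam0 : 0 ≤ ν * θ ^ 2 := by positivity
  have hlam1 : ν * θ ^ 2 < 2 * eps1 L := by
    have h1 : ν * θ ^ 2 < 4 / Real.pi ^ 2 * θ ^ 2 := mul_lt_mul_of_pos_right hν4 (by positivity)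
    have h2 : 4 / Real.pi ^ 2 * θ ^ 2 = 2 * (2 / Real.pi ^ 2 * θ ^ 2) := by ring
    linarith
  have hmain := lamPart_le_capacity L (by omega) (ν * θ ^ 2) hlam0 hlam1 x y
  have hcap := (capacity_KT_bounds48 L hL ν hν0 hν).2
  rw [hθ] at hmain ⊢
  set R : ℝ := (x : ℝ) ^ 2 + (y : ℝ) ^ 2 with hR
  have hR0 : 0 ≤ R := by positivity
  have hlogL : 0 ≤ Real.log L := Real.log_nonneg (by linarith)
  -- `G̃_λ(0) ≤ log L/(2π) + 0.0687`
  have hG : Gres L (ν * (2 * Real.pi / L) ^ 2) 0 ≤ Real.log L / (2 * Real.pi) + 0.0687 := by nlinarith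
  have hG0 : 0 ≤ Real.log L / (2 * Real.pi) + 0.0687 := by positivity
  refine hmain.trans ?_
  -- `(π²/8) R (ν θ²) G ≤ ν R (7.76 log L + 3.3)/L²`
  have e1 : Real.pi ^ 2 / 8 * R * (ν * (2 * Real.pi / L) ^ 2) * Gres L (ν * (2 * Real.pi / L) ^ 2) 0
      = (ν * R / (L : ℝ) ^ 2) * (Real.pi ^ 4 / 2 * Gres L (ν * (2 * Real.pi / L) ^ 2) 0) := by
    field_simp; ring
  have e2 : ν * R * (7.76 * Real.log L + 3.35) / (L : ℝ) ^ 2 = (ν * R / (L : ℝ) ^ 2) * (7.76 * Real.log L + 3.35) := by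
    ring
  rw [e1, e2]
  apply mul_le_mul_of_nonneg_left _ (by positivity)
  have hπ2 : Real.pi ^ 2 ≤ 9.8697 := by nlinarith
  have hπ3 : Real.pi ^ 3 ≤ 31.007 := by nlinarith [mul_le_mul hπ2 hπhi.le hπ.le (by norm_num)]
  have hπ4 : Real.pi ^ 4 ≤ 97.42 := by nlinarith [mul_le_mul hπ2 hπ2 (by positivity) (by norm_num)]
  have h1 : Real.pi ^ 4 / 2 * Gres L (ν * (2 * Real.pi / L) ^ 2) 0
      ≤ Real.pi ^ 4 / 2 * (Real.log L / (2 * Real.pi) + 0.0687) :=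
    mul_le_mul_of_nonneg_left hG (by positivity)
  have h2 : Real.pi ^ 4 / 2 * (Real.log L / (2 * Real.pi) + 0.0687)
      = Real.pi ^ 3 / 4 * Real.log L + Real.pi ^ 4 / 2 * 0.0687 := by
    field_simp; ring
  rw [h2] at h1
  nlinarith [mul_le_mul_of_nonneg_right hπ3 hlogL]

end CapacityConst

end Summit.HubbardSuperconductivity.HubbardSuperconductivity.Theorems.AnisotropyChord.Transfer.Fibre3

end
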